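import Summits.Ventures.HodgeRepro2.T6N2Toy
import Summits.Ventures.HodgeRepro2.T6N3Toy
import Summits.Ventures.HodgeRepro2.T6N3Main2

/-!
# T6N3Toy2 — the §10.5(ii)(c)/(d) witness for the v2 isotypic step (`N3iso_of_datum₂`)

Cell pub-hodge-repro2, Tier 6 (README §10), seat t6-p3 (N3 owner, M2). Proof lane, count-neutral.
On the toy N3 datum `N3Toy.toy` (T6N3Toy, p401452) and t6-p5's toy N2 datum `N2Toy.toyDatum h6 F P 𝒟`
(T6N2Toy: admissible sets `Set.univ`), the ONE new binder of the v2 isotypic step — the sentence N2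
and N3 share, `N2Datum.AdmGenerating`, and its stronger form `AdmSpanning` — hold outright
(`toyDatum_admSpanning`, `toyDatum_admGenerating`; so does the stable-route sentence `AdmStable`,
`toyDatum_admStable`), and `N3iso_of_datum₂` fires with every binder discharged (`toy_N3iso₂`): an
ADMISSIBLE quadruple with a non-zero pairing exists on the toy. Nothing of `N3iso_main₂`'s other
binders changes from v1 (T6N3Toy's `toy_N3iso`).

§8(d): uses an L-value-free non-vanishing device: NO.
-/

namespace Summit.Ventures.HodgeRepro2.T6.N3Toy

open scoped InnerProductSpace

variable {K : Type*} [Field K] [NumberField K] [NumberField.IsCMField K]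

/-- The toy N2 datum's admissible sets are everything, so they span: `AdmSpanning` on the toy (for
every N3 datum `𝒟`). -/
theorem toyDatum_admSpanning (h6 : Module.finrank ℚ K = 6) (F : FaceSetting K) (P : NDatum F)
    (𝒟 : N3Datum) : (N2Toy.toyDatum h6 F P 𝒟).AdmSpanning :=
  let s := N2Toy.toyDatum_spec h6 F P 𝒟
  (N2Toy.toyDatum h6 F P 𝒟).admSpanning_of_univ s.2.2.2.2.1 s.2.2.2.2.2.1 s.2.2.2.2.2.2.1
    s.2.2.2.2.2.2.2

/-- The sentence N2 and N3 share, `AdmGenerating`, on the toy (from the spanning form). -/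
theorem toyDatum_admGenerating (h6 : Module.finrank ℚ K = 6) (F : FaceSetting K) (P : NDatum F)
    (𝒟 : N3Datum) : (N2Toy.toyDatum h6 F P 𝒟).AdmGenerating :=
  (N2Toy.toyDatum h6 F P 𝒟).admGenerating_of_admSpanning (toyDatum_admSpanning h6 F P 𝒟)

/-- The stable-route sentence `AdmStable` holds on the toy as well (the spans are `⊤`). -/
theorem toyDatum_admStable (h6 : Module.finrank ℚ K = 6) (F : FaceSetting K) (P : NDatum F)
    (𝒟 : N3Datum) : (N2Toy.toyDatum h6 F P 𝒟).AdmStable := by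
  obtain ⟨hA, hB, hC, hD⟩ := toyDatum_admSpanning h6 F P 𝒟
  refine ⟨fun _ _ _ => ?_, fun _ _ _ => ?_, fun _ _ _ => ?_, fun _ _ _ => ?_⟩
  · rw [hA]; exact Submodule.mem_top
  · rw [hB]; exact Submodule.mem_top
  · rw [hC]; exact Submodule.mem_top
  · rw [hD]; exact Submodule.mem_top

/-- (d) for the v2 assembly: on the toy N3 datum with the toy N2 datum, an ADMISSIBLE single pair of
products with a non-zero pairing — every binder of `N3iso_of_datum₂` discharged. -/
theorem toy_N3iso₂ (h6 : Module.finrank ℚ K = 6) (F : FaceSetting K) (P : NDatum F) :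
    ∃ (φa : toy.A.Sa) (φb : toy.A.Sb) (φc : toy.B.Sa) (φd : toy.B.Sb),
      (N2Toy.toyDatum h6 F P toy).AdmData (φa, φb, φc, φd) ∧
        ⟪toy.B.F φc φd, toy.A.F φa φb⟫_ℂ ≠ 0 :=
  (N2Toy.toyDatum h6 F P toy).N3iso_of_datum₂_gen (toyDatum_admGenerating h6 F P toy)
    toy_AutOrthogonal toy_AutStable toy_AutSimple toy_AutNonIso toy_ProductsIn20
    toy_ProductEquivariant toy_ProductsIn20 toy_ProductEquivariant toy_SigmaIsAut rfl toy_N3A toy_N3A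

end Summit.Ventures.HodgeRepro2.T6.N3Toy
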